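import Summits.CriticalPhenomena.CardyFormulaZ2.Theses.CardyFlipRusso
import Literature.Barriers.CriticalPhenomena.CoveringLatticeShift

/-!
# Line `complex-fugacity-symmetric-point` for the crux `CardyFlipRusso.CoveringLeg`
(item stmt-CriticalPhenomena-6435, route `CardyFlipRusso`, rank 6) — CHECKED SKELETON (crux-plan, round 1)

The crux: Cardy's formula for crude site crossings of `G_s = ℤ² ∪ (ℤ² + (½,½))` at `1/2`
(= Beffara's mixed model `P_{1/2,1/2}`) implies Cardy's formula for the crude bond-`ℤ²` event
`embDomainCrossing squareLatticeEmbedding.z` (= `P_{1/2,0}` on `G_s` by Kesten's covering graph).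

Idea (card `Cruxes/CoveringLeg/Ideas/complex-fugacity-symmetric-point.md`, triage r1: 2 × pass).
Beffara's family `q ↦ P_{1/2,q}` is an exponential (Esscher) tilt of the ANTECEDENT: with `t = 1 − 2q`,
`ε_f = −1` on type-II (even) faces and `+1` on type-III (odd) faces (the tree's `mixedParam`), and
`χ_f = ±1` the centre spin,
`P_{1/2,q}[U] = E_{1/2}[1_U ∏_f (1 + t ε_f χ_f)] = Σ_{S ⊆ faces} t^{|S|} (∏_{f∈S} ε_f) E_{1/2}[1_U ∏_{f∈S} χ_f] =: Φ_{R,δ}(t)`,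
a POLYNOMIAL in `t` whose value at `t = 0` is the antecedent's crossing probability (definitionally,
`Phi_zero`) and at `t = 1` the `q = 0` (bond-`ℤ²`) one (`Sig.stub_esscher`). The crux is
`Φ_{R,δ}(1) − Φ_{R,δ}(0) → 0`; the line gets it from complex analysis in `t`:

* `Sig.stub_complexTiltBound` (K1, the card's distinctive bet — HARDEST): `Φ_{R,δ}` is bounded on a
  fixed complex box around the segment `[0,1]`, uniformly in small `δ` (equivalently: `q ↦ P_{1/2,q}[U_δ]`
  is real-analytic on `[0,½]` with radius and constants uniform in `δ` — "no operator worse than marginal is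
  generated at any order of the staggered tilt");
* `Sig.stub_firstOrderFlatness` + `Sig.stub_higherOrderFlatness` (K2, at the SYMMETRIC point only, under the
  crux hypothesis): every jet `Φ^{(k)}_{R,δ}(0) → 0` (k = 1: the staggered pivotal count at `q = ½` =
  the response of the type-II pivotal mass to a one-mesh domain shift → 0; k ≥ 2: integrated colour-odd
  five-arm nulls of the CLE₆ point, the triage's sharpening of the card's K3 — shared in content with line
  `five-arm-null` and `CardySectorGap.VertexFacePivotalBalance`/`DomainShiftBalance`);
* `Sig.stub_vitaliGlue` (provable now): a family holomorphic and uniformly bounded on the box whose jets at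
  `0` all tend to `0` tends to `0` at `1` (Montel + identity theorem, or Hadamard three-circles along a chain
  of discs);
* `Sig.stub_coveringEndpoint`: Cardy for `P_{1/2,0}` crude `G_s` crossings ⇒ Cardy for crude bond-`ℤ²`
  crossings (Kesten's covering graph + RSW control of boundary-grazing paths; the unrotated twin of
  `CardySectorGap.CoveringBridge`, stmt-CriticalPhenomena-7055).

Composition `CoveringLeg_of : Sig.stub_esscher → Sig.stub_complexTiltBound → Sig.stub_firstOrderFlatness →
Sig.stub_higherOrderFlatness → Sig.stub_vitaliGlue → Sig.stub_coveringEndpoint → CoveringLeg` is a real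
proof (`Tendsto` algebra, `Phi_zero`, `differentiable_Phi`); `sorry` occurs only in the six `stub_*`.
No `Disproof.lean` exists for this crux (2026-08-16); negatives index: no mixed-model statement.
-/

noncomputable section

namespace Summit.CriticalPhenomena.CardyFormulaZ2.Cruxes.CoveringLeg.ComplexFugacitySymmetricPoint

open scoped BigOperators Topology Classical
open Filter Set MeasureTheory
open Literature.Probability.RandomPlanarGeometry Literature.Probability.Percolation
open Literature.Probability.LatticeModels
open Literature.Barriers.CriticalPhenomena (MixedSite mixedParam)

/-! ### The crux's objects (the `let`s of `CardyFlipRusso.CoveringLeg`, named) -/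

/-- The embedding of `G_s` into `ℂ`: `inl x ↦ x`, `inr f ↦ f + (½,½)` (the `let z` of the crux). -/
def zEmb : MixedSite → ℂ :=
  Sum.elim (fun x ↦ (x.1 : ℂ) + (x.2 : ℂ) * Complex.I)
    (fun f ↦ ((f.1 : ℂ) + 1 / 2) + ((f.2 : ℂ) + 1 / 2) * Complex.I)

/-- The centred square lattice graph `G_s` (the `let G` of the crux). -/
def gS : SimpleGraph MixedSite :=
  SimpleGraph.fromRel (fun a b ↦ a.isLeft = true ∧
    ((b.isLeft = true ∧ dist (zEmb a) (zEmb b) = 1) ∨ (b.isRight = true ∧ dist (zEmb a) (zEmb b) < 1)))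

/-- The crude crossing event `U_{R,δ}` of the conformal rectangle `R` at mesh `δ` on `G_s`
(open path inside `δ⁻¹Ω`, endpoints within `2δ` of the arcs `0` and `2`). -/
def crudeEvent (R : ConformalRectangle) (δ : ℝ) : Set (SiteConfig MixedSite) :=
  {ω | ∃ u v, Metric.infDist ((δ : ℂ) * zEmb u) (R.arc 0) ≤ 2 * δ ∧
      Metric.infDist ((δ : ℂ) * zEmb v) (R.arc 2) ≤ 2 * δ ∧
      ω ∈ siteConnIn gS {y | (δ : ℂ) * zEmb y ∈ R.carrier} u v}

/-- The antecedent's family: crude site crossing probability under site percolation at `1/2` on `G_s`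
(= Beffara's `P_{1/2,1/2}`). -/
def siteProb (R : ConformalRectangle) (δ : ℝ) : ℝ :=
  (sitePercolation MixedSite half).real (crudeEvent R δ)

/-- The consequent's family: crude bond-`ℤ²` crossing probability at `1/2`. -/
def bondProb (R : ConformalRectangle) (δ : ℝ) : ℝ :=
  (bondPercolation (zdGraph 2) half).real
    (embDomainCrossing squareLatticeEmbedding.z R.carrier δ (R.arc 0) (R.arc 2))

/-- Beffara's mixed family: the crude event under `P_{1/2,q} = prodBernoulli (mixedParam q)`
(type I open w.p. `1/2`, type II (even faces) w.p. `q`, type III (odd faces) w.p. `1 − q`). -/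
def mixedProb (q : unitInterval) (R : ConformalRectangle) (δ : ℝ) : ℝ :=
  (prodBernoulli (mixedParam q)).real (crudeEvent R δ)

/-- The antecedent of `CoveringLeg`. -/
def SiteCardy : Prop :=
  ∀ R : ConformalRectangle, R.HasCrossingLimit (siteProb R) cardyFunction

/-- The consequent of `CoveringLeg`. -/
def BondCardy : Prop :=
  ∀ R : ConformalRectangle, R.HasCrossingLimit (bondProb R) cardyFunction

/-- `CoveringLeg` is literally `SiteCardy → BondCardy` (the `let`s zeta-reduce). -/
theorem coveringLeg_iff : Theses.CardyFlipRusso.CoveringLeg ↔ (SiteCardy → BondCardy) :=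
  Iff.rfl

/-! ### The Esscher polynomial `Φ_{R,δ}(t)` -/

/-- Chessboard sign of the tilt direction: `−1` on type-II (even) faces, `+1` on type-III (odd) faces, so
that the `P_{1/2,q}`-weight of "centre `f` open" is `(1 + (1 − 2q) ε_f)/2` (`q` resp. `1 − q`). -/
def eps (f : ℤ × ℤ) : ℝ := if Even (f.1 + f.2) then -1 else 1

/-- The centre spin `χ_f(ω) = +1` if the centre of the face `f` is open, `−1` if closed. -/
def spin (f : ℤ × ℤ) (ω : SiteConfig MixedSite) : ℝ := if Sum.inr f ∈ ω then 1 else -1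

/-- The faces whose centre lies in `δ⁻¹Ω` — the only centres `U_{R,δ}` depends on; finite for `δ > 0`
(`R.carrier` is bounded), junk `∅` otherwise. -/
def faces (R : ConformalRectangle) (δ : ℝ) : Finset (ℤ × ℤ) :=
  if h : {f : ℤ × ℤ | (δ : ℂ) * zEmb (Sum.inr f) ∈ R.carrier}.Finite then h.toFinset else ∅

/-- Walsh–Esscher coefficient `a_S(R,δ) = (∏_{f∈S} ε_f) · E_{1/2}[1_U ∏_{f∈S} χ_f]`. -/
def coeff (R : ConformalRectangle) (δ : ℝ) (S : Finset (ℤ × ℤ)) : ℝ :=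
  (∏ f ∈ S, eps f) * ∫ ω in crudeEvent R δ, ∏ f ∈ S, spin f ω ∂(sitePercolation MixedSite half)

/-- The complexified Esscher tilt `Φ_{R,δ}(t) = Σ_{S ⊆ faces} a_S t^{|S|}`, an entire function of the
complex defect parameter `t` (`t = 1 − 2q` on Beffara's family). -/
def Phi (R : ConformalRectangle) (δ : ℝ) (t : ℂ) : ℂ :=
  ∑ S ∈ (faces R δ).powerset, (coeff R δ S : ℂ) * t ^ S.card

/-- The open complex box of half-width `r` around the segment `[0,1]`. -/
def tiltBox (r : ℝ) : Set ℂ := {t | -r < t.re ∧ t.re < 1 + r ∧ |t.im| < r}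

/-! ### Stub signatures (`Sig.stub_X` is the statement of `stub_X`) -/

/-- ESSCHER IDENTITY (exact, provable now; finite-dimensional distributions of the two product
measures on the window `δ⁻¹Ω`, `prodBernoulli_real_eq_sum_cube` + `Finset.prod_one_add`):
`P_{1/2,q}[U_{R,δ}] = Φ_{R,δ}(1 − 2q)` for every `q ∈ [0,1]` and `δ > 0`. -/
def Sig.stub_esscher : Prop :=
  ∀ (R : ConformalRectangle) (δ : ℝ), 0 < δ → ∀ q : unitInterval,
    Phi R δ ((1 : ℂ) - 2 * (((q : ℝ) : ℂ))) = ((mixedProb q R δ : ℝ) : ℂ)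

/-- K1 — COMPLEX TILT BOUND (the line's distinctive bet; hardest stub): for every conformal rectangle
there are `r > 0` and `M` with `‖Φ_{R,δ}(t)‖ ≤ M` on the box `tiltBox r ⊃ [0,1]` for all small `δ > 0`.
A priori only `((|1+t|+|1−t|)/2)^{#faces}`; the content is cancellation uniform in `δ`. -/
def Sig.stub_complexTiltBound : Prop :=
  ∀ R : ConformalRectangle, ∃ r : ℝ, 0 < r ∧ ∃ M : ℝ,
    ∀ᶠ δ in 𝓝[>] (0 : ℝ), ∀ t ∈ tiltBox r, ‖Phi R δ t‖ ≤ M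

/-- K2 (k = 1) — FIRST-ORDER FLATNESS AT THE SYMMETRIC POINT, under the crux hypothesis:
`Φ'_{R,δ}(0) = Σ_f ε_f E_{1/2}[1_U χ_f] = ½ (E_{1/2} N_III − E_{1/2} N_II) → 0` (staggered pivotal count of
site-`G_s`; by the odd translation = change of the type-II pivotal mass under a one-mesh domain shift). -/
def Sig.stub_firstOrderFlatness : Prop :=
  SiteCardy → ∀ R : ConformalRectangle, Tendsto (fun δ ↦ deriv (Phi R δ) 0) (𝓝[>] 0) (𝓝 0)

/-- K2 (k ≥ 2) — HIGHER-ORDER FLATNESS AT THE SYMMETRIC POINT, under the crux hypothesis: every jet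
`Φ^{(k)}_{R,δ}(0) = k! Σ_{|S|=k} a_S → 0` (level-`k` staggered Walsh sums of the site-`G_s` crossing
indicator; near parts = integrated colour-odd five-arm nulls of the CLE₆ point, far parts = domain-shift
continuity). -/
def Sig.stub_higherOrderFlatness : Prop :=
  SiteCardy → ∀ R : ConformalRectangle, ∀ k : ℕ, 2 ≤ k →
    Tendsto (fun δ ↦ iteratedDeriv k (Phi R δ) 0) (𝓝[>] 0) (𝓝 0)

/-- VITALI GLUE (pure complex analysis, provable now): a family of functions holomorphic and uniformly
bounded on a fixed box around `[0,1]`, all of whose jets at `0` tend to `0`, tends to `0` at `1` minus its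
value at `0` (Montel + identity theorem on the connected box; or Cauchy estimates + Hadamard three
circles along the chain of discs `D(j r/4, r)`). -/
def Sig.stub_vitaliGlue : Prop :=
  ∀ (Ψ : ℝ → ℂ → ℂ) (r M : ℝ), 0 < r →
    (∀ᶠ δ in 𝓝[>] (0 : ℝ), DifferentiableOn ℂ (Ψ δ) (tiltBox r) ∧ ∀ t ∈ tiltBox r, ‖Ψ δ t‖ ≤ M) →
    (∀ k : ℕ, 1 ≤ k → Tendsto (fun δ ↦ iteratedDeriv k (Ψ δ) 0) (𝓝[>] 0) (𝓝 0)) →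
    Tendsto (fun δ ↦ Ψ δ 1 - Ψ δ 0) (𝓝[>] 0) (𝓝 0)

/-- COVERING ENDPOINT (Kesten's covering graph + boundary RSW): Cardy for the crude `G_s` crossings under
`P_{1/2,0}` (type III = odd centres open a.s. = the vertices of a `45°`-rotated `√2`-scaled `ℤ²` whose edge
midpoints are the type-I sites; type II closed a.s.) implies Cardy for the crude bond-`ℤ²` event
`embDomainCrossing squareLatticeEmbedding.z` — the unrotated twin of `CardySectorGap.CoveringBridge`. -/
def Sig.stub_coveringEndpoint : Prop :=
  (∀ R : ConformalRectangle, R.HasCrossingLimit (mixedProb 0 R) cardyFunction) → BondCardy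

/-! ### Stubs (registered; `sorry` only here) -/

/-- STUB S1: Esscher identity. -/
theorem stub_esscher : Sig.stub_esscher := by
  sorry

/-- STUB S2 (hardest): complex tilt bound K1. -/
theorem stub_complexTiltBound : Sig.stub_complexTiltBound := by
  sorry

/-- STUB S3: first-order flatness at `q = ½`. -/
theorem stub_firstOrderFlatness : Sig.stub_firstOrderFlatness := by
  sorry

/-- STUB S4: higher-order flatness at `q = ½`. -/
theorem stub_higherOrderFlatness : Sig.stub_higherOrderFlatness := by
  sorry

/-- STUB S5: Vitali glue. -/
theorem stub_vitaliGlue : Sig.stub_vitaliGlue := by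
  sorry

/-- STUB S6: covering endpoint. -/
theorem stub_coveringEndpoint : Sig.stub_coveringEndpoint := by
  sorry

/-! ### Glue (sorry-free) -/

/-- `Φ_{R,δ}(0)` is the antecedent's crossing probability: only `S = ∅` survives, and
`a_∅ = ∫_U 1 dP_{1/2} = P_{1/2}(U)`. -/
theorem Phi_zero (R : ConformalRectangle) (δ : ℝ) : Phi R δ 0 = ((siteProb R δ : ℝ) : ℂ) := by
  unfold Phi
  rw [Finset.sum_eq_single_of_mem ∅ (Finset.empty_mem_powerset _)]
  · simp [coeff, siteProb]
  · intro S _ hS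
    have hc : S.card ≠ 0 := by rwa [Ne, Finset.card_eq_zero]
    simp [zero_pow hc]

/-- `Φ_{R,δ}` is a polynomial in `t`, hence entire. -/
theorem differentiable_Phi (R : ConformalRectangle) (δ : ℝ) : Differentiable ℂ (Phi R δ) := by
  have : Phi R δ = fun t ↦ ∑ S ∈ (faces R δ).powerset, (coeff R δ S : ℂ) * t ^ S.card := rfl
  rw [this]
  refine Differentiable.fun_sum fun S _ ↦ ?_
  exact (differentiable_const _).mul (differentiable_pow _)

/-- K1 + K2 + Vitali: the Esscher polynomial is asymptotically flat between `t = 0` and `t = 1`. -/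
theorem tendsto_Phi_one_sub_Phi_zero (hB : Sig.stub_complexTiltBound) (h1 : Sig.stub_firstOrderFlatness)
    (h2 : Sig.stub_higherOrderFlatness) (hV : Sig.stub_vitaliGlue) (hA : SiteCardy)
    (R : ConformalRectangle) :
    Tendsto (fun δ ↦ Phi R δ 1 - Phi R δ 0) (𝓝[>] 0) (𝓝 0) := by
  obtain ⟨r, hr, M, hM⟩ := hB R
  refine hV (Phi R) r M hr (hM.mono fun δ h ↦ ⟨(differentiable_Phi R δ).differentiableOn, h⟩) ?_
  intro k hk
  rcases Nat.lt_or_ge k 2 with hlt | hge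
  · obtain rfl : k = 1 := by omega
    simpa only [iteratedDeriv_one] using h1 hA R
  · exact h2 hA R k hge

/-- Under the crux hypothesis the `q = 0` mixed crossing probabilities obey Cardy's formula. -/
theorem mixedZero_hasCrossingLimit (hE : Sig.stub_esscher) (hB : Sig.stub_complexTiltBound)
    (h1 : Sig.stub_firstOrderFlatness) (h2 : Sig.stub_higherOrderFlatness) (hV : Sig.stub_vitaliGlue)
    (hA : SiteCardy) (R : ConformalRectangle) :
    R.HasCrossingLimit (mixedProb 0 R) cardyFunction := by
  intro φ x hφ
  have hflat := tendsto_Phi_one_sub_Phi_zero hB h1 h2 hV hA R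
  -- the antecedent, cast to `ℂ`
  have hS : Tendsto (fun δ ↦ ((siteProb R δ : ℝ) : ℂ)) (𝓝[>] 0)
      (𝓝 ((cardyFunction (crossRatio x) : ℝ) : ℂ)) :=
    tendsto_ofReal_iff.mpr (hA R φ x hφ)
  -- `Φ(1) = (Φ(1) − Φ(0)) + Φ(0) → 0 + F(η)`
  have hP1 : Tendsto (fun δ ↦ Phi R δ 1) (𝓝[>] 0) (𝓝 ((cardyFunction (crossRatio x) : ℝ) : ℂ)) := by
    have h := hflat.add hS
    rw [zero_add] at h
    refine h.congr' (Eventually.of_forall fun δ ↦ ?_)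
    simp only [Phi_zero]
    ring
  -- `Φ(1) = P_{1/2,0}(U)` for `δ > 0` (Esscher at `q = 0`)
  have hE' : ∀ᶠ δ in 𝓝[>] (0 : ℝ), Phi R δ 1 = ((mixedProb 0 R δ : ℝ) : ℂ) := by
    filter_upwards [self_mem_nhdsWithin] with δ hδ
    have h := hE R δ hδ 0
    have h0 : (((0 : unitInterval) : ℝ) : ℂ) = 0 := by simp
    rw [h0, mul_zero, sub_zero] at h
    exact h
  exact tendsto_ofReal_iff.mp (hP1.congr' hE')

/-- COMPOSITION: the six stubs give the crux, by name. -/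
theorem CoveringLeg_of : Sig.stub_esscher → Sig.stub_complexTiltBound → Sig.stub_firstOrderFlatness →
    Sig.stub_higherOrderFlatness → Sig.stub_vitaliGlue → Sig.stub_coveringEndpoint →
    Theses.CardyFlipRusso.CoveringLeg :=
  fun hE hB h1 h2 hV hC ↦ coveringLeg_iff.2 fun hA ↦
    hC fun R ↦ mixedZero_hasCrossingLimit hE hB h1 h2 hV hA R

/-- The crux from the (sorried) stubs — the skeleton closes once the six stubs are proved. -/
theorem CoveringLeg_proof : Theses.CardyFlipRusso.CoveringLeg :=
  CoveringLeg_of stub_esscher stub_complexTiltBound stub_firstOrderFlatness stub_higherOrderFlatness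
    stub_vitaliGlue stub_coveringEndpoint

end Summit.CriticalPhenomena.CardyFormulaZ2.Cruxes.CoveringLeg.ComplexFugacitySymmetricPoint

end
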